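import Literature.NumberTheory.LFunctions.MertensZeroCertificate
import Literature.NumberTheory.LFunctions.TuringMethodTuringBound
import HarnessLib

/-!
# Brent 1979, `H(75 000 001)`: the statement reduced to the data of its computation

Topic `Literature/NumberTheory/LFunctions` (trunk T-ANT). Companion of the named fact
`Literature.NumberTheory.LFunctions.Brent1979_zerosSimpleOnLine`
(`MertensConjectureDisproofProofs.lean`):

> "the Riemann zeta function `ζ(s)` has exactly 75 000 000 zeros of the form `σ + it` in the
> region `0 < t < 32 585 736.4`; all these zeros are simple and lie on the line `σ = ½`"
> [Brent1979, Abstract]; in the notation of §1, `H(75 000 001)` holds and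
> `N(32 585 736.4) = 75 000 000` (§4, p. 1365).

## Status of the discharge: not discharged (XL), reduced to the computation's data

The printed proof (§4–§5 of the source) is a certified *computation*: about `1.06 · 10⁸`
evaluations of Hardy's function `Z(t)` by the Riemann–Siegel formula (2.6) with the remainder
bound (2.8) `|R₂(τ)| < 3 τ^{-7/4}` (`τ > 2000`) and the rounding-error bound (5.2), locating
`n + 1 = 75 000 001` sign changes of `Z` in `(g₋₁, g_n)`, closed by Turing's method in Lehman's form
(Theorem 3.1: `∫_u^v S(t) dt ≤ 0.114 log v + 1.71` for `168π ≤ u < v`; Theorem 3.2, Gram blocks)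
which gives `N(g_n) ≤ n + 1`. No checkable certificate of a computation of this size exists or
is feasible here: the tree's certified zero counts reach `N(19) = 1` in the kernel
(`ZetaNineteenCertificate.lean`) and `N(2516) = 2000` by compiled evaluation
(`MertensCertificate/Top.lean`, order-2 Euler–Maclaurin with `10³` terms at `330` bits), whereas
Brent's range holds `7.5 · 10⁷` zeros at heights up to `3.26 · 10⁷`, where Euler–Maclaurin needs
more than `5 · 10⁶` terms per point and a Riemann–Siegel evaluator with a proved remainder bound is
not in the tree. (The completeness step rests on Turing's bound for `∫ S`, the named fact
`abs_integral_zetaArgS_le_turing`, which *is* discharged in the tree: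
`Literature.NumberTheory.LFunctions.abs_integral_zetaArgS_le_turing_holds`,
`TuringMethodTuringBound.lean`.) So `Brent1979_zerosSimpleOnLine_holds` is **not** proved here.
Everything *but* the computation is proved, and this file assembles it into the exact shape of
Brent's argument — which, unlike a plain verification of RH up to `T`
(`Literature.NumberTheory.DiophantineGeometry.RiemannHypothesisUpTo.of_turing`,
`TuringMethod.lean`), also yields **simplicity**: `N(T)` counts multiplicity, so once the
located *distinct* zeros on the line exhaust the count, every zero below `T` is one of them and
has multiplicity one (§1, §4 of the source: "`N(g_n) = n + 1`, and `H(n + 1)` holds").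

## Contents (namespace `Literature.NumberTheory.LFunctions`, everything proved)

* `simple_onLine_upTo_of_located_zeros` — **the `H(n)` criterion**: if `Z` is a set of ordinates
  `0 < γ ≤ T` of zeros of `ζ` on the critical line and `N(T) ≤ |Z|`, then every zero `ρ` of `ζ`
  with `0 < Im ρ ≤ T` is on the line, simple, with ordinate in `Z`, and `N(T) = |Z|`
  (the `≤ T` form of `zeros_below_of_count_eq_card`, `MertensZeroCertificate.lean`, for all `ρ`
  rather than `ρ` in the open strip).
* `exists_finset_zeros_of_hardyZ_sign_changes` — `k` strict sign changes of `Z` along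
  `t₀ < ⋯ < t_k` give `k` distinct ordinates of zeros of `ζ` on the line in `(t₀, t_k)` (IVT and
  `Z(t) = 0 ↔ ζ(½ + it) = 0`).
* `simple_onLine_upTo_of_turing` — **Turing's method with simplicity**: the data
  (i) `n` sign changes of `Z` along `0 ≤ t₀ < ⋯ < t_n ≤ T`, (ii) `m` sign changes along
  `T ≤ s₀ < ⋯ < s_m ≤ T + h`, (iii) `∫_T^{T+h} S ≤ B`, (iv) one real inequality, give: all zeros
  with `0 < Im ρ ≤ T` are simple and on the line, and `N(T) = N₀(T) = n`.
* `Brent1979_zerosSimpleOnLine_of_forall_le`, `Brent1979_zerosSimpleOnLine_of_located_zeros`,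
  `Brent1979_zerosSimpleOnLine_of_turing`, `Brent1979_zerosSimpleOnLine_of_turing_lehman` — the
  named fact from, respectively: the same statement up to any height `T ≥ 32 585 736.4`;
  `75 000 000` (or any number `≥ N(T₀)`) located ordinates below `T₀ = 32 585 736.4`; Turing data
  at `T₀` with an arbitrary bound `B` for `∫ S`; Turing data at `T₀` with the Turing–Lehman bound
  `Literature.NumberTheory.LFunctions.abs_integral_zetaArgS_le_turing` (a named fact of
  `TuringMethod.lean`, taken as a hypothesis).
* `Brent1979_zerosSimpleOnLine_of_hardyZ_signs` — **the unconditional reduction**: the same with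
  Turing's bound *proved* (`abs_integral_zetaArgS_le_turing_holds`) plugged in, so that the only
  hypotheses left are the certified signs of `Z` at finitely many points below and just above
  `T₀` and one explicit real inequality — exactly the data of the source's computation.

## References

* [Brent1979] R. P. Brent, *On the zeros of the Riemann zeta function in the critical strip*,
  Math. Comp. 33 (1979) 1361–1372: Abstract; §1 (`H(n)`); §3 Theorems 3.1–3.2; §4; §5 (5.2).
* [EdwardsZeta1974] H. M. Edwards, *Riemann's Zeta Function*, 1974, §8.2–8.3 (Turing's method).
-/

noncomputable section

open Complex Set MeasureTheory intervalIntegral Finset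
open scoped Real

namespace Literature.NumberTheory.LFunctions

/-! ## The `H(n)` criterion: located zeros exhausting the count -/

/-- **The `H(n)` criterion** (Brent §1, §4). If `Z` is a finite set of ordinates `0 < γ ≤ T` of
zeros of `ζ` on the critical line and `N(T) ≤ |Z|` (`N` counts with multiplicity), then every
zero `ρ` of `ζ` with `0 < Im ρ ≤ T` lies on the critical line, is simple, and has its ordinate in
`Z`; and `N(T) = |Z|`. (A zero with `Im ρ ≠ 0` lies in the open critical strip, so no strip
hypothesis is needed: `re_pos_of_riemannZeta_eq_zero`, `re_lt_one_of_riemannZeta_eq_zero`.)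
[cite: Brent1979, §4 (N(g_n) = n + 1, hence H(n + 1))] -/
theorem simple_onLine_upTo_of_located_zeros {T : ℝ} (Z : Finset ℝ)
    (hZ : ∀ γ ∈ Z, riemannZeta (1 / 2 + γ * I) = 0 ∧ 0 < γ ∧ γ ≤ T)
    (hN : zetaZeroCount T ≤ Z.card) :
    (∀ ρ : ℂ, riemannZeta ρ = 0 → 0 < ρ.im → ρ.im ≤ T →
        ρ.re = 1 / 2 ∧ deriv riemannZeta ρ ≠ 0 ∧ ρ.im ∈ Z) ∧
      zetaZeroCount T = Z.card := by
  classical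
  have hfin : (zetaZeroBox 0 T).Finite := zetaZeroBox_finite 0 T
  set B : Finset ℂ := hfin.toFinset with hBdef
  set e : ℝ → ℂ := fun γ ↦ 1 / 2 + γ * I with he
  have heinj : Function.Injective e := by
    intro x y hxy
    have := congrArg Complex.im hxy
    simpa [he] using this
  set E : Finset ℂ := Z.image e with hE
  have hEcard : E.card = Z.card := Finset.card_image_of_injective _ heinj
  have hEB : E ⊆ B := by
    intro ρ hρ
    rw [hE, Finset.mem_image] at hρ
    obtain ⟨γ, hγ, rfl⟩ := hρ
    obtain ⟨h0, h1, h2⟩ := hZ γ hγ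
    rw [hBdef, Set.Finite.mem_toFinset]
    have hre : (e γ).re = 1 / 2 := by simp [he]
    have him : (e γ).im = γ := by simp [he]
    refine ⟨h0, ?_, ?_, ?_, ?_⟩
    · rw [hre]; norm_num
    · rw [hre]; norm_num
    · rw [him]; exact h1
    · rw [him]; exact h2
  -- multiplicities are `≥ 1` on the box
  have hne1 : ∀ ρ ∈ B, ρ ≠ 1 := by
    intro ρ hρ h1
    rw [hBdef, Set.Finite.mem_toFinset] at hρ
    have := hρ.2.2.2.1
    rw [h1] at this; simp at this
  have hord1 : ∀ ρ ∈ B, 1 ≤ riemannZetaZeroOrder ρ := by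
    intro ρ hρ
    have hρ' := hρ
    rw [hBdef, Set.Finite.mem_toFinset] at hρ'
    have := (riemannZetaZeroOrder_pos_iff (hne1 ρ hρ)).2 hρ'.1
    omega
  -- `N(T)` as a `Finset.sum`
  have hnonneg : 0 ≤ ∑ ρ ∈ B, riemannZetaZeroOrder ρ :=
    Finset.sum_nonneg fun ρ hρ ↦ by linarith [hord1 ρ hρ]
  have hNdef : (zetaZeroCount T : ℤ) = ∑ ρ ∈ B, riemannZetaZeroOrder ρ := by
    have h1 : zetaZeroCount T = (∑ᶠ ρ ∈ zetaZeroBox 0 T, riemannZetaZeroOrder ρ).toNat := rfl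
    rw [h1, finsum_mem_eq_finite_toFinset_sum _ hfin]
    exact Int.toNat_of_nonneg hnonneg
  -- `|B| ≤ Σ_B m = N(T) ≤ |Z| = |E| ≤ |B|`
  have hcardB : (B.card : ℤ) ≤ ∑ ρ ∈ B, riemannZetaZeroOrder ρ := by
    have := Finset.sum_le_sum (s := B) (f := fun _ ↦ (1 : ℤ)) (g := riemannZetaZeroOrder) hord1
    simpa using this
  have hEleB : E.card ≤ B.card := Finset.card_le_card hEB
  have hN' : ∑ ρ ∈ B, riemannZetaZeroOrder ρ ≤ (E.card : ℤ) := by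
    rw [← hNdef, hEcard]
    exact_mod_cast hN
  have hBcard_le : B.card ≤ E.card := by exact_mod_cast hcardB.trans hN'
  have hBE : B = E := (Finset.eq_of_subset_of_card_le hEB hBcard_le).symm
  have hsum_eq : ∑ ρ ∈ B, riemannZetaZeroOrder ρ = B.card := by
    refine le_antisymm ?_ hcardB
    calc ∑ ρ ∈ B, riemannZetaZeroOrder ρ ≤ (E.card : ℤ) := hN'
      _ = B.card := by rw [hBE]
  have hordE : ∀ ρ ∈ B, riemannZetaZeroOrder ρ = 1 := eq_one_of_sum_eq_card B _ hord1 hsum_eq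
  refine ⟨fun ρ h0 h1 h2 ↦ ?_, ?_⟩
  · have hρB : ρ ∈ B := by
      rw [hBdef, Set.Finite.mem_toFinset]
      exact DiophantineGeometry.mem_zetaZeroBox_of_riemannZeta_eq_zero h0 h1 h2
    have hd : deriv riemannZeta ρ ≠ 0 := deriv_ne_zero_of_order_eq_one (hne1 ρ hρB) (hordE ρ hρB)
    have hρE : ρ ∈ E := hBE ▸ hρB
    rw [hE, Finset.mem_image] at hρE
    obtain ⟨γ, hγ, rfl⟩ := hρE
    exact ⟨by simp [he], hd, by simpa [he] using hγ⟩
  · have : (zetaZeroCount T : ℤ) = (Z.card : ℤ) := by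
      rw [hNdef, hsum_eq, hBE, hEcard]
    exact_mod_cast this

/-! ## Sign changes of `Z` locate distinct zeros on the line -/

/-- **Sign changes locate zeros (IVT).** If Hardy's function has strict sign changes
`Z(t_i) Z(t_{i+1}) < 0` along points `t₀ < t₁ < ⋯ < t_k`, then there is a set of `k` distinct
ordinates `γ ∈ (t₀, t_k)` with `ζ(½ + iγ) = 0` (one in each `(t_i, t_{i+1})`; a zero of `Z` is a
zero of `ζ` on the line, `Literature.NumberTheory.LFunctions.hardyZ_eq_zero_iff_holds`). This is
the public form of the located-zeros step of `le_criticalZeroCount_of_sign_changes`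
(`TuringMethod.lean`).
[cite: Brent1979, §2.1 and §4] -/
theorem exists_finset_zeros_of_hardyZ_sign_changes {k : ℕ} (t : Fin (k + 1) → ℝ)
    (ht : StrictMono t) (hsign : ∀ i : Fin k, hardyZ (t i.castSucc) * hardyZ (t i.succ) < 0) :
    ∃ Z : Finset ℝ, Z.card = k ∧
      ∀ γ ∈ Z, riemannZeta (1 / 2 + γ * I) = 0 ∧ t 0 < γ ∧ γ < t (Fin.last k) := by
  classical
  have hzero : ∀ i : Fin k, ∃ c, hardyZ c = 0 ∧ t i.castSucc < c ∧ c < t i.succ := by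
    intro i
    have hlt : t i.castSucc < t i.succ := ht Fin.castSucc_lt_succ
    have h0 : (0 : ℝ) ∈ uIcc (hardyZ (t i.castSucc)) (hardyZ (t i.succ)) := by
      rcases mul_neg_iff.1 (hsign i) with ⟨h1, h2⟩ | ⟨h1, h2⟩
      · exact mem_uIcc.2 (Or.inr ⟨h2.le, h1.le⟩)
      · exact mem_uIcc.2 (Or.inl ⟨h1.le, h2.le⟩)
    obtain ⟨c, hc, hfc⟩ := intermediate_value_uIcc continuous_hardyZ.continuousOn h0
    rw [uIcc_of_le hlt.le] at hc
    have hne1 : c ≠ t i.castSucc := by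
      rintro rfl
      exact (mul_neg_iff.1 (hsign i)).elim (fun h ↦ h.1.ne' hfc) (fun h ↦ h.1.ne hfc)
    have hne2 : c ≠ t i.succ := by
      rintro rfl
      exact (mul_neg_iff.1 (hsign i)).elim (fun h ↦ h.2.ne hfc) (fun h ↦ h.2.ne' hfc)
    exact ⟨c, hfc, lt_of_le_of_ne hc.1 hne1.symm, lt_of_le_of_ne hc.2 hne2⟩
  choose c hc using hzero
  have hcmono : StrictMono c := by
    intro i j hij
    calc c i < t i.succ := (hc i).2.2
      _ ≤ t j.castSucc := ht.monotone (by
          rw [Fin.le_iff_val_le_val, Fin.val_succ, Fin.val_castSucc]; exact hij)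
      _ < c j := (hc j).2.1
  refine ⟨Finset.univ.image c, ?_, ?_⟩
  · rw [Finset.card_image_of_injective _ hcmono.injective, Finset.card_univ, Fintype.card_fin]
  · intro x hx
    rw [Finset.mem_image] at hx
    obtain ⟨i, -, rfl⟩ := hx
    refine ⟨(hardyZ_eq_zero_iff_holds _).1 (hc i).1, ?_, ?_⟩
    · exact lt_of_le_of_lt (ht.monotone (Fin.zero_le _)) (hc i).2.1
    · exact lt_of_lt_of_le (hc i).2.2 (ht.monotone (Fin.le_last _))

/-! ## Turing's method with simplicity -/

/-- **Turing's method with simplicity** (the architecture of Brent's verification of `H(n)`).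
Data: (i) `n` strict sign changes of `Z` along `0 ≤ t₀ < ⋯ < t_n ≤ T`; (ii) `m` strict sign
changes of `Z` along `T ≤ s₀ < ⋯ < s_m ≤ T + h` (`0 ≤ h`); (iii) a bound `∫_T^{T+h} S(t) dt ≤ B`
(Turing–Lehman, Brent's Theorem 3.1; or Trudgian's); (iv) the inequality
`B + ∫_T^{T+h} (θ(t)/π + 1) dt − Σ_{j<m} (T + h − s_{j+1}) < h (n + 1)`.
Conclusion: every zero `ρ` of `ζ` with `0 < Im ρ ≤ T` is simple and on the critical line, and
`N(T) = N₀(T) = n`. (Steps: (ii)–(iv) give `N(T) ≤ n` by `zetaZeroCount_le_of_turing`; (i) gives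
`n` distinct zeros on the line below `T`; then `simple_onLine_upTo_of_located_zeros`.)
[cite: Brent1979, §3 Theorem 3.1–3.2 and §4] [cite: EdwardsZeta1974, §8.2] -/
theorem simple_onLine_upTo_of_turing {T h B : ℝ} {n m : ℕ} (hh : 0 ≤ h)
    (t : Fin (n + 1) → ℝ) (ht : StrictMono t) (ht0 : 0 ≤ t 0) (htn : t (Fin.last n) ≤ T)
    (htsign : ∀ i : Fin n, hardyZ (t i.castSucc) * hardyZ (t i.succ) < 0)
    (s : Fin (m + 1) → ℝ) (hs : StrictMono s) (hs0 : T ≤ s 0) (hsm : s (Fin.last m) ≤ T + h)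
    (hssign : ∀ i : Fin m, hardyZ (s i.castSucc) * hardyZ (s i.succ) < 0)
    (hS : ∫ t in T..T + h, zetaArgS t ≤ B)
    (hnum : B + (∫ t in T..T + h, (riemannSiegelTheta t / π + 1)) - ∑ i : Fin m, (T + h - s i.succ)
        < h * (n + 1)) :
    (∀ ρ : ℂ, riemannZeta ρ = 0 → 0 < ρ.im → ρ.im ≤ T →
        ρ.re = 1 / 2 ∧ deriv riemannZeta ρ ≠ 0) ∧
      zetaZeroCount T = n ∧ criticalZeroCount T = n := by
  have hT : 0 ≤ T := ht0.trans ((ht.monotone (Fin.zero_le _)).trans htn)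
  obtain ⟨Z', hZ', hsum⟩ := exists_finset_zeros_above_of_sign_changes s hs hs0 hsm hssign
  have hup : zetaZeroCount T ≤ n := zetaZeroCount_le_of_turing hT hh Z' hZ' hS (by linarith)
  obtain ⟨Z, hcard, hZ⟩ := exists_finset_zeros_of_hardyZ_sign_changes t ht htsign
  have hZT : ∀ γ ∈ Z, riemannZeta (1 / 2 + γ * I) = 0 ∧ 0 < γ ∧ γ ≤ T := fun γ hγ ↦
    ⟨(hZ γ hγ).1, ht0.trans_lt (hZ γ hγ).2.1, ((hZ γ hγ).2.2.le.trans htn)⟩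
  obtain ⟨hall, hcount⟩ := simple_onLine_upTo_of_located_zeros Z hZT (hcard ▸ hup)
  obtain ⟨-, -, hcrit⟩ := DiophantineGeometry.RiemannHypothesisUpTo.of_turing hh t ht ht0 htn htsign
    s hs hs0 hsm hssign hS hnum
  exact ⟨fun ρ h0 h1 h2 ↦ ⟨(hall ρ h0 h1 h2).1, (hall ρ h0 h1 h2).2.1⟩, hcard ▸ hcount, hcrit⟩

/-! ## Brent's statement from the data of a computation at `T₀ = 32 585 736.4` -/

/-- `Brent1979_zerosSimpleOnLine` follows from "every zero with `0 < Im ρ ≤ T` is simple and on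
the line" at any height `T ≥ 32 585 736.4` (the region of the source is `0 < t < 32 585 736.4`).
[cite: Brent1979, Abstract] -/
theorem Brent1979_zerosSimpleOnLine_of_forall_le {T : ℝ} (hT : 32585736.4 ≤ T)
    (h : ∀ ρ : ℂ, riemannZeta ρ = 0 → 0 < ρ.im → ρ.im ≤ T →
      ρ.re = 1 / 2 ∧ deriv riemannZeta ρ ≠ 0) :
    Brent1979_zerosSimpleOnLine :=
  fun ρ h0 h1 h2 ↦ h ρ h0 h1 (h2.le.trans hT)

/-- **Brent's statement from located zeros and the count**: if `Z` is a set of ordinates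
`0 < γ ≤ 32 585 736.4` of zeros of `ζ` on the critical line with `N(32 585 736.4) ≤ |Z|` (in the
source: `|Z| = N = 75 000 000`, §4), then `Brent1979_zerosSimpleOnLine` holds.
[cite: Brent1979, §4] -/
theorem Brent1979_zerosSimpleOnLine_of_located_zeros (Z : Finset ℝ)
    (hZ : ∀ γ ∈ Z, riemannZeta (1 / 2 + γ * I) = 0 ∧ 0 < γ ∧ γ ≤ 32585736.4)
    (hN : zetaZeroCount 32585736.4 ≤ Z.card) : Brent1979_zerosSimpleOnLine :=
  Brent1979_zerosSimpleOnLine_of_forall_le le_rfl fun ρ h0 h1 h2 ↦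
    ⟨((simple_onLine_upTo_of_located_zeros Z hZ hN).1 ρ h0 h1 h2).1,
      ((simple_onLine_upTo_of_located_zeros Z hZ hN).1 ρ h0 h1 h2).2.1⟩

/-- **Brent's statement from Turing data at `T₀ = 32 585 736.4`** with an arbitrary certified
bound `∫_{T₀}^{T₀+h} S ≤ B`: the data (i)–(iv) of `simple_onLine_upTo_of_turing` at `T = T₀` imply
`Brent1979_zerosSimpleOnLine` (and `N(T₀) = N₀(T₀) = n`; in the source `n = 75 000 000`).
[cite: Brent1979, §3–§4] -/
theorem Brent1979_zerosSimpleOnLine_of_turing {h B : ℝ} {n m : ℕ} (hh : 0 ≤ h)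
    (t : Fin (n + 1) → ℝ) (ht : StrictMono t) (ht0 : 0 ≤ t 0)
    (htn : t (Fin.last n) ≤ 32585736.4)
    (htsign : ∀ i : Fin n, hardyZ (t i.castSucc) * hardyZ (t i.succ) < 0)
    (s : Fin (m + 1) → ℝ) (hs : StrictMono s) (hs0 : 32585736.4 ≤ s 0)
    (hsm : s (Fin.last m) ≤ 32585736.4 + h)
    (hssign : ∀ i : Fin m, hardyZ (s i.castSucc) * hardyZ (s i.succ) < 0)
    (hS : ∫ t in (32585736.4 : ℝ)..32585736.4 + h, zetaArgS t ≤ B)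
    (hnum : B + (∫ t in (32585736.4 : ℝ)..32585736.4 + h, (riemannSiegelTheta t / π + 1))
        - ∑ i : Fin m, (32585736.4 + h - s i.succ) < h * (n + 1)) :
    Brent1979_zerosSimpleOnLine ∧ zetaZeroCount 32585736.4 = n ∧
      criticalZeroCount 32585736.4 = n := by
  obtain ⟨hall, hN, hN₀⟩ :=
    simple_onLine_upTo_of_turing hh t ht ht0 htn htsign s hs hs0 hsm hssign hS hnum
  exact ⟨Brent1979_zerosSimpleOnLine_of_forall_le le_rfl hall, hN, hN₀⟩

/-- The height of Brent's verification exceeds the threshold `168π` of the Turing–Lehman bound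
(`C = 168π` in Brent's Theorem 3.1). [cite: Brent1979, §3 Theorem 3.1] -/
theorem turing_threshold_lt_brent_height : 168 * π < (32585736.4 : ℝ) := by
  have := Real.pi_lt_four
  linarith

/-- **Brent's statement from Turing data at `T₀ = 32 585 736.4`, with the Turing–Lehman bound for
`∫ S` plugged in** (the named fact `abs_integral_zetaArgS_le_turing` of `TuringMethod.lean`, the
tree's form of Brent's Theorem 3.1, taken as a hypothesis): certified sign changes of `Z` below and
just above `T₀` and the single inequality
`2.30 + 0.128 log ((T₀ + h)/2π) + ∫_{T₀}^{T₀+h} (θ/π + 1) − Σ_j (T₀ + h − s_{j+1}) < h (n + 1)`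
imply `Brent1979_zerosSimpleOnLine`. This is the exact shape of the source's verification:
everything but the certified signs of `Z` and one explicit real inequality is proved.
[cite: Brent1979, §3 Theorem 3.1 and §4] -/
theorem Brent1979_zerosSimpleOnLine_of_turing_lehman (hTu : abs_integral_zetaArgS_le_turing)
    {h : ℝ} {n m : ℕ} (hh : 0 < h)
    (t : Fin (n + 1) → ℝ) (ht : StrictMono t) (ht0 : 0 ≤ t 0)
    (htn : t (Fin.last n) ≤ 32585736.4)
    (htsign : ∀ i : Fin n, hardyZ (t i.castSucc) * hardyZ (t i.succ) < 0)
    (s : Fin (m + 1) → ℝ) (hs : StrictMono s) (hs0 : 32585736.4 ≤ s 0)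
    (hsm : s (Fin.last m) ≤ 32585736.4 + h)
    (hssign : ∀ i : Fin m, hardyZ (s i.castSucc) * hardyZ (s i.succ) < 0)
    (hnum : 2.30 + 0.128 * Real.log ((32585736.4 + h) / (2 * π))
        + (∫ t in (32585736.4 : ℝ)..32585736.4 + h, (riemannSiegelTheta t / π + 1))
        - ∑ i : Fin m, (32585736.4 + h - s i.succ) < h * (n + 1)) :
    Brent1979_zerosSimpleOnLine ∧ zetaZeroCount 32585736.4 = n ∧
      criticalZeroCount 32585736.4 = n :=
  Brent1979_zerosSimpleOnLine_of_turing hh.le t ht ht0 htn htsign s hs hs0 hsm hssign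
    (abs_le.1 (hTu turing_threshold_lt_brent_height (by linarith))).2 hnum

/-- **Brent's statement from the data of its computation (all analysis discharged).** Certified
strict sign changes of Hardy's function `Z` along `0 ≤ t₀ < ⋯ < t_n ≤ T₀ = 32 585 736.4` (in the
source `n = 75 000 000`, located by `≈ 1.06 · 10⁸` Riemann–Siegel evaluations, §4–§5) and along
`T₀ ≤ s₀ < ⋯ < s_m ≤ T₀ + h` (`h > 0`), together with the single explicit inequality
`2.30 + 0.128 log ((T₀ + h)/2π) + ∫_{T₀}^{T₀+h} (θ(t)/π + 1) dt − Σ_{j<m} (T₀ + h − s_{j+1}) < h (n + 1)`,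
imply `Brent1979_zerosSimpleOnLine` together with `N(T₀) = N₀(T₀) = n`. This is
`Brent1979_zerosSimpleOnLine_of_turing_lehman` with Turing's bound
`|∫_{t₁}^{t₂} S| ≤ 2.30 + 0.128 log(t₂/2π)` (`168π < t₁ < t₂`) supplied by its discharge
`Literature.NumberTheory.LFunctions.abs_integral_zetaArgS_le_turing_holds`
(`TuringMethodTuringBound.lean`; Brent's Theorem 3.1 is Lehman's sharper form
`0.114 log v + 1.71`, not needed here). What is *not* supplied is the computation itself: no
certificate of `7.5 · 10⁷` sign changes of `Z` at heights up to `3.26 · 10⁷` is available to the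
kernel (see the module docstring). [cite: Brent1979, §3 Theorems 3.1–3.2 and §4]
[cite: EdwardsZeta1974, §8.2 (1)] -/
theorem Brent1979_zerosSimpleOnLine_of_hardyZ_signs {h : ℝ} {n m : ℕ} (hh : 0 < h)
    (t : Fin (n + 1) → ℝ) (ht : StrictMono t) (ht0 : 0 ≤ t 0)
    (htn : t (Fin.last n) ≤ 32585736.4)
    (htsign : ∀ i : Fin n, hardyZ (t i.castSucc) * hardyZ (t i.succ) < 0)
    (s : Fin (m + 1) → ℝ) (hs : StrictMono s) (hs0 : 32585736.4 ≤ s 0)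
    (hsm : s (Fin.last m) ≤ 32585736.4 + h)
    (hssign : ∀ i : Fin m, hardyZ (s i.castSucc) * hardyZ (s i.succ) < 0)
    (hnum : 2.30 + 0.128 * Real.log ((32585736.4 + h) / (2 * π))
        + (∫ t in (32585736.4 : ℝ)..32585736.4 + h, (riemannSiegelTheta t / π + 1))
        - ∑ i : Fin m, (32585736.4 + h - s i.succ) < h * (n + 1)) :
    Brent1979_zerosSimpleOnLine ∧ zetaZeroCount 32585736.4 = n ∧
      criticalZeroCount 32585736.4 = n :=
  Brent1979_zerosSimpleOnLine_of_turing_lehman abs_integral_zetaArgS_le_turing_holds hh t ht ht0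
    htn htsign s hs hs0 hsm hssign hnum

end Literature.NumberTheory.LFunctions
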